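import Summits.NavierStokesRegularity.NavierStokesRegularity.Theses.SelfMixingDichotomy
import Summits.NavierStokesRegularity.NavierStokesRegularity.Theorems.SelfMixingDichotomySequentialTypeIExclusionStubLerayHopfLocalEnergySolution
import Summits.NavierStokesRegularity.NavierStokesRegularity.Theorems.SelfMixingDichotomySequentialTypeIExclusionStubContinuationPastFinalTime
import Summits.NavierStokesRegularity.NavierStokesRegularity.Theorems.SelfMixingDichotomySequentialTypeIExclusionStubFinalTimeTypeISingularPoint
import Literature.Analysis.FluidPDE.NSBoundedHigherRegularityOfLemma61
import Literature.Analysis.FluidPDE.PartialRegularity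

/-!
# Crux `SelfMixingDichotomy.SequentialTypeIExclusion` (stmt-NavierStokesRegularity-1424), line `registered`:
  STRUCTURE of the crux — helper file (`--supports`)

S1 = `SequentialTypeIExclusion`: for every `M`, every classical Leray–Hopf solution `u` (ν = 1) on
`ℝ³ × [0,T)` from a rapidly decaying datum and every `x₀`, Type-I WINDOWS at arbitrarily small scales
(`∀ r₀ > 0 ∃ r ∈ (0,r₀), C(r; T, x₀) ≤ M`, `C = cknC` on backward cylinders) force boundedness of `u` near
`(T, x₀)` (BDD).

This file machine-checks the exact logical structure the line leads (0, c1, c2, c3) found, with every piece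
now in `Theorems/` (the closed twin `Cruxes/…/Lines/birth_closed.lean` and the converse bookkeeping
`Lines/registered_BddConverse.lean` were crux workfiles only):

* `cknC_le_of_bdd`, `cknC_typeIBound_of_bdd` — at a point of local boundedness `C(r; T, x₀) ≤ |B₁| M³ r³`, so the
  centred cubic Type-I bound holds there (lead 0's converse bookkeeping);
* `windowsForceTypeI_of_sequentialTypeIExclusion` — hence S1 implies the registered open stub
  `stub_windowsForceTypeI` (no scale-intermittency) VERBATIM: the stub is a necessary condition of the crux;
* `supForm_of_sequentialTypeIExclusion` — S1 implies its SUP-FORM (final-time centred Type-I exclusion for the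
  class: `∃ r₁ > 0 ∀ r ∈ (0,r₁), C(r) ≤ M ⇒ BDD`), trivially;
* `sequentialTypeIExclusion_of_windowsForceTypeI_of_supForm` and `sequentialTypeIExclusion_iff` —
  **S1 ⇔ (no scale-intermittency) ∧ (sup-form)**: the line's cut is lossless;
* `supForm_of_not_typeISingularityExists` — the sup-form follows from the REGISTERED conjecture decl
  `Literature.Analysis.FluidPDE.TypeISingularityExists` negated (centred Type-I exclusion, Seregin's open
  question), using the three landed KNOWN stubs of reshape r4 (continuation of `u` past its final time as a local
  energy solution, p157188 + p156995, and the packaging of a final-time centred Type-I point as an interior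
  `IsTypeISingularPoint`, p157669);
* `sequentialTypeIExclusion_of_windowsForceTypeI_of_not_typeISingularityExists` — the registered skeleton's
  composition with its two OPEN stubs as hypotheses: **S1 ⇐ (no scale-intermittency) ∧ ¬TypeISingularityExists**.

So the open content of the crux is exactly: (a) `¬ TypeISingularityExists` (registered, open) and (b) no
scale-intermittency (unnamed in print; necessary for S1 by `windowsForceTypeI_of_sequentialTypeIExclusion`).
-/

noncomputable section

-- the summit and its single problem share the name (D-0017 nested layout)
set_option linter.dupNamespace false

namespace Summit.NavierStokesRegularity.NavierStokesRegularity.Theorems.SequentialTypeIExclusion.Registered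

open scoped ENNReal NNReal Topology
open Literature.Analysis.FluidPDE Set Filter MeasureTheory Function Metric

/-! ### The converse bookkeeping: `C(r) = O(r³)` at a point of local boundedness -/

section Bdd

variable {T : ℝ} {u : ℝ → EuclideanSpace ℝ (Fin 3) → EuclideanSpace ℝ (Fin 3)}
  {x₀ : EuclideanSpace ℝ (Fin 3)} {ρ M : ℝ}

/-- **The cubic functional of a locally bounded field**: if `‖u t x‖ ≤ M` for `t ∈ (T − ρ², T)`,
`x ∈ B_ρ(x₀)`, then `C(r; T, x₀) ≤ ofReal (M³ r³) · |B₁|` for every `0 < r ≤ ρ`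
(`|Q_r| = r⁵ |B₁|`; the tree's `cknC_le_of_ae_bound_subset`). -/
theorem cknC_le_of_bdd (hM : 0 ≤ M)
    (hB : ∀ t ∈ Ioo (T - ρ ^ 2) T, ∀ x ∈ ball x₀ ρ, ‖u t x‖ ≤ M) {r : ℝ} (hr : 0 < r)
    (hrρ : r ≤ ρ) :
    cknC r ((T, x₀) : ℝ × EuclideanSpace ℝ (Fin 3)) u ≤
      ENNReal.ofReal (M ^ 3 * r ^ 3) * volume (ball (0 : EuclideanSpace ℝ (Fin 3)) 1) := by
  -- adapted from the crux workfile `Cruxes/SequentialTypeIExclusion/Lines/registered_BddConverse.lean` (lead 0)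
  have hsub : parabolicCylinder r ((T, x₀) : ℝ × EuclideanSpace ℝ (Fin 3)) ⊆
      parabolicCylinder ρ ((T, x₀) : ℝ × EuclideanSpace ℝ (Fin 3)) := by
    refine prod_mono (Ioo_subset_Ioo ?_ le_rfl) (ball_subset_ball hrρ)
    dsimp only
    nlinarith [pow_le_pow_left₀ hr.le hrρ 2]
  have hbd : ∀ᵐ w ∂(volume.restrict (parabolicCylinder ρ ((T, x₀) : ℝ × EuclideanSpace ℝ (Fin 3)))),
      ‖u w.1 w.2‖ ≤ M := by
    rw [ae_restrict_iff' (isOpen_parabolicCylinder ρ _).measurableSet]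
    refine ae_of_all _ fun w hw => ?_
    rw [mem_parabolicCylinder] at hw
    exact hB w.1 ⟨hw.1.1, hw.1.2⟩ w.2 (mem_ball.2 hw.2)
  exact cknC_le_of_ae_bound_subset hM hbd hr hsub

/-- **The centred cubic Type-I bound at a point of local boundedness**: if `u` is bounded by `M` on
`(T − ρ², T) × B_ρ(x₀)`, `ρ > 0`, then `C(r; T, x₀) ≤ (max M 0)³ ρ³ |B₁|` for all `0 < r < ρ`. -/
theorem cknC_typeIBound_of_bdd (hρ : 0 < ρ)
    (hB : ∀ t ∈ Ioo (T - ρ ^ 2) T, ∀ x ∈ ball x₀ ρ, ‖u t x‖ ≤ M) :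
    ∃ M' : ℝ, ∃ r₁ : ℝ, 0 < r₁ ∧ ∀ r ∈ Ioo 0 r₁,
      cknC r ((T, x₀) : ℝ × EuclideanSpace ℝ (Fin 3)) u ≤ ENNReal.ofReal M' := by
  -- adapted from the crux workfile `Cruxes/SequentialTypeIExclusion/Lines/registered_BddConverse.lean` (lead 0)
  have hB' : ∀ t ∈ Ioo (T - ρ ^ 2) T, ∀ x ∈ ball x₀ ρ, ‖u t x‖ ≤ max M 0 :=
    fun t ht x hx => (hB t ht x hx).trans (le_max_left _ _)
  set K : ℝ≥0∞ := volume (ball (0 : EuclideanSpace ℝ (Fin 3)) 1) with hK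
  have hKtop : K ≠ ∞ := measure_ball_lt_top.ne
  refine ⟨(max M 0) ^ 3 * ρ ^ 3 * K.toReal, ρ, hρ, fun r hr => ?_⟩
  calc cknC r ((T, x₀) : ℝ × EuclideanSpace ℝ (Fin 3)) u
      ≤ ENNReal.ofReal ((max M 0) ^ 3 * r ^ 3) * K := cknC_le_of_bdd (le_max_right _ _) hB' hr.1 hr.2.le
    _ ≤ ENNReal.ofReal ((max M 0) ^ 3 * ρ ^ 3) * K := by
        refine mul_le_mul_left (ENNReal.ofReal_le_ofReal ?_) K
        exact mul_le_mul_of_nonneg_left (pow_le_pow_left₀ hr.1.le hr.2.le 3)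
          (pow_nonneg (le_max_right _ _) 3)
    _ = ENNReal.ofReal ((max M 0) ^ 3 * ρ ^ 3 * K.toReal) := by
        rw [ENNReal.ofReal_mul' ENNReal.toReal_nonneg, ENNReal.ofReal_toReal hKtop]

end Bdd

/-! ### S1 ⇒ its two halves -/

/-- **S1 implies the registered open stub `stub_windowsForceTypeI` (no scale-intermittency), verbatim.**
At a point where the windows hypothesis holds, S1 gives boundedness of `u`, and a bounded field has
`C(r; T, x₀) = O(r³)` (`cknC_typeIBound_of_bdd`). So the stub is a NECESSARY condition of the crux. -/
theorem windowsForceTypeI_of_sequentialTypeIExclusion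
    (hS1 : Theses.SelfMixingDichotomy.SequentialTypeIExclusion) :
    ∀ M : ℝ, ∀ T : ℝ, 0 < T →
      ∀ (u : ℝ → EuclideanSpace ℝ (Fin 3) → EuclideanSpace ℝ (Fin 3))
        (p : ℝ → EuclideanSpace ℝ (Fin 3) → ℝ),
        IsClassicalNSSolutionOn (Set.Ico 0 T) 1 0 u p →
        IsLerayHopfOn T 1 0 (u 0) u →
        HasRapidSpatialDecay (u 0) →
        ∀ x₀ : EuclideanSpace ℝ (Fin 3),
          (∀ r₀ : ℝ, 0 < r₀ → ∃ r ∈ Set.Ioo 0 r₀,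
            cknC r ((T, x₀) : ℝ × EuclideanSpace ℝ (Fin 3)) u ≤ ENNReal.ofReal M) →
          ∃ M' : ℝ, ∃ r₁ : ℝ, 0 < r₁ ∧ ∀ r ∈ Set.Ioo 0 r₁,
            cknC r ((T, x₀) : ℝ × EuclideanSpace ℝ (Fin 3)) u ≤ ENNReal.ofReal M' := by
  intro M T hT u p hcl hLH hdec x₀ hwin
  obtain ⟨ρ, hρ, N, hN⟩ := hS1 M T hT u p hcl hLH hdec x₀ hwin
  exact cknC_typeIBound_of_bdd hρ hN

/-- **S1 implies its SUP-FORM** (final-time centred Type-I exclusion for the class): a centred cubic Type-I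
bound `C(r; T, x₀) ≤ M` for ALL `0 < r < r₁` in particular gives windows at arbitrarily small scales. -/
theorem supForm_of_sequentialTypeIExclusion
    (hS1 : Theses.SelfMixingDichotomy.SequentialTypeIExclusion) :
    ∀ M : ℝ, ∀ T : ℝ, 0 < T →
      ∀ (u : ℝ → EuclideanSpace ℝ (Fin 3) → EuclideanSpace ℝ (Fin 3))
        (p : ℝ → EuclideanSpace ℝ (Fin 3) → ℝ),
        IsClassicalNSSolutionOn (Set.Ico 0 T) 1 0 u p →
        IsLerayHopfOn T 1 0 (u 0) u →
        HasRapidSpatialDecay (u 0) →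
        ∀ x₀ : EuclideanSpace ℝ (Fin 3),
          (∃ r₁ : ℝ, 0 < r₁ ∧ ∀ r ∈ Set.Ioo 0 r₁,
            cknC r ((T, x₀) : ℝ × EuclideanSpace ℝ (Fin 3)) u ≤ ENNReal.ofReal M) →
          ∃ ρ : ℝ, 0 < ρ ∧ ∃ M : ℝ, ∀ t ∈ Set.Ioo (T - ρ ^ 2) T, ∀ x ∈ Metric.ball x₀ ρ, ‖u t x‖ ≤ M := by
  intro M T hT u p hcl hLH hdec x₀ hTI
  obtain ⟨r₁, hr₁, hC⟩ := hTI
  refine hS1 M T hT u p hcl hLH hdec x₀ fun r₀ hr₀ => ?_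
  refine ⟨min r₀ r₁ / 2, ⟨by positivity, ?_⟩, hC _ ⟨by positivity, ?_⟩⟩
  · linarith [min_le_left r₀ r₁, lt_min hr₀ hr₁]
  · linarith [min_le_right r₀ r₁, lt_min hr₀ hr₁]

/-! ### The two halves ⇒ S1, and the equivalence -/

/-- **S1 from its two halves**: no scale-intermittency (windows ⇒ centred Type-I bound, the registered stub
`stub_windowsForceTypeI`) and the sup-form (centred Type-I bound ⇒ BDD) compose to S1, by pure logic. -/
theorem sequentialTypeIExclusion_of_windowsForceTypeI_of_supForm
    (hwin : ∀ M : ℝ, ∀ T : ℝ, 0 < T →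
      ∀ (u : ℝ → EuclideanSpace ℝ (Fin 3) → EuclideanSpace ℝ (Fin 3))
        (p : ℝ → EuclideanSpace ℝ (Fin 3) → ℝ),
        IsClassicalNSSolutionOn (Set.Ico 0 T) 1 0 u p →
        IsLerayHopfOn T 1 0 (u 0) u →
        HasRapidSpatialDecay (u 0) →
        ∀ x₀ : EuclideanSpace ℝ (Fin 3),
          (∀ r₀ : ℝ, 0 < r₀ → ∃ r ∈ Set.Ioo 0 r₀,
            cknC r ((T, x₀) : ℝ × EuclideanSpace ℝ (Fin 3)) u ≤ ENNReal.ofReal M) →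
          ∃ M' : ℝ, ∃ r₁ : ℝ, 0 < r₁ ∧ ∀ r ∈ Set.Ioo 0 r₁,
            cknC r ((T, x₀) : ℝ × EuclideanSpace ℝ (Fin 3)) u ≤ ENNReal.ofReal M')
    (hsup : ∀ M : ℝ, ∀ T : ℝ, 0 < T →
      ∀ (u : ℝ → EuclideanSpace ℝ (Fin 3) → EuclideanSpace ℝ (Fin 3))
        (p : ℝ → EuclideanSpace ℝ (Fin 3) → ℝ),
        IsClassicalNSSolutionOn (Set.Ico 0 T) 1 0 u p →
        IsLerayHopfOn T 1 0 (u 0) u →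
        HasRapidSpatialDecay (u 0) →
        ∀ x₀ : EuclideanSpace ℝ (Fin 3),
          (∃ r₁ : ℝ, 0 < r₁ ∧ ∀ r ∈ Set.Ioo 0 r₁,
            cknC r ((T, x₀) : ℝ × EuclideanSpace ℝ (Fin 3)) u ≤ ENNReal.ofReal M) →
          ∃ ρ : ℝ, 0 < ρ ∧ ∃ M : ℝ, ∀ t ∈ Set.Ioo (T - ρ ^ 2) T, ∀ x ∈ Metric.ball x₀ ρ, ‖u t x‖ ≤ M) :
    Theses.SelfMixingDichotomy.SequentialTypeIExclusion := by
  intro M T hT u p hcl hLH hdec x₀ hlim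
  obtain ⟨M', r₁, hr₁, hTI⟩ := hwin M T hT u p hcl hLH hdec x₀ hlim
  exact hsup M' T hT u p hcl hLH hdec x₀ ⟨r₁, hr₁, hTI⟩

/-- **Structure theorem of the crux: S1 ⇔ (no scale-intermittency) ∧ (sup-form).** The line's cut of the
crux into the registered stub `stub_windowsForceTypeI` and final-time centred Type-I exclusion is LOSSLESS. -/
theorem sequentialTypeIExclusion_iff : Summit.NavierStokesRegularity.NavierStokesRegularity.Theses.SelfMixingDichotomy.SequentialTypeIExclusion ↔ ((∀ M : ℝ, ∀ T : ℝ, 0 < T → ∀ (u : ℝ → EuclideanSpace ℝ (Fin 3) → EuclideanSpace ℝ (Fin 3)) (p : ℝ → EuclideanSpace ℝ (Fin 3) → ℝ), Literature.Analysis.FluidPDE.IsClassicalNSSolutionOn (Set.Ico 0 T) 1 0 u p → Literature.Analysis.FluidPDE.IsLerayHopfOn T 1 0 (u 0) u → Literature.Analysis.FluidPDE.HasRapidSpatialDecay (u 0) → ∀ x₀ : EuclideanSpace ℝ (Fin 3), (∀ r₀ : ℝ, 0 < r₀ → ∃ r ∈ Set.Ioo 0 r₀, Literature.Analysis.FluidPDE.cknC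 r ((T, x₀) : ℝ × EuclideanSpace ℝ (Fin 3)) u ≤ ENNReal.ofReal M) → ∃ M' : ℝ, ∃ r₁ : ℝ, 0 < r₁ ∧ ∀ r ∈ Set.Ioo 0 r₁, Literature.Analysis.FluidPDE.cknC r ((T, x₀) : ℝ × EuclideanSpace ℝ (Fin 3)) u ≤ ENNReal.ofReal M') ∧ (∀ M : ℝ, ∀ T : ℝ, 0 < T → ∀ (u : ℝ → EuclideanSpace ℝ (Fin 3) → EuclideanSpace ℝ (Fin 3)) (p : ℝ → EuclideanSpace ℝ (Fin 3) → ℝ), Literature.Analysis.FluidPDE.IsClassicalNSSolutionOn (Set.Ico 0 T) 1 0 u p → Literature.Analysis.FluidPDE.IsLerayHopfOn T 1 0 (u 0) u → Literature.Analysis.FluidPDE.HasRapidSpatialDecay (u 0) → ∀ x₀ : EuclideanSpace ℝ (Fin 3), (∃ r₁ : ℝ, 0 < r₁ ∧ ∀ r ∈ Set.Ioo 0 r₁, Literature.Analysis.FluidPDE.cknC r ((T, x₀) : ℝ × EuclideanSpace ℝ (Fin 3)) u ≤ ENNReal.ofReal M) → ∃ ρ : ℝ, 0 < ρ ∧ ∃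 M : ℝ, ∀ t ∈ Set.Ioo (T - ρ ^ 2) T, ∀ x ∈ Metric.ball x₀ ρ, ‖u t x‖ ≤ M)) :=
  ⟨fun h => ⟨windowsForceTypeI_of_sequentialTypeIExclusion h, supForm_of_sequentialTypeIExclusion h⟩,
    fun h => sequentialTypeIExclusion_of_windowsForceTypeI_of_supForm h.1 h.2⟩

/-! ### The sup-form from the registered conjecture decl `TypeISingularityExists` -/

/-- **The sup-form of the crux (final-time centred Type-I exclusion for classical Leray–Hopf solutions) follows
from `¬ TypeISingularityExists`** (the registered conjecture decl negated = centred Type-I exclusion for suitable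
weak solutions, Seregin's open question). Proof = the r4 composition without its first stub: if `u` were
unbounded near `(T, x₀)` under a centred cubic Type-I bound, continue `u` (with its gauged pressure, a local energy
solution on `(0,T)`, p157188) past the final time `T` (p156995; the final slice has finite energy in the
Leray–Hopf class) and package `(T, x₀)` as a centred Type-I singular INTERIOR point of the continuation
(p157669) — a witness of `TypeISingularityExists`. (The decay hypothesis on the datum is not used.) -/
theorem supForm_of_not_typeISingularityExists : ¬ Literature.Analysis.FluidPDE.TypeISingularityExists → ∀ M : ℝ, ∀ T : ℝ, 0 < T → ∀ (u : ℝ → EuclideanSpace ℝ (Fin 3) → EuclideanSpace ℝ (Fin 3)) (p : ℝ → EuclideanSpace ℝ (Fin 3) → ℝ), Literature.Analysis.FluidPDE.IsClassicalNSSolutionOn (Set.Ico 0 T) 1 0 u p → Literature.Analysis.FluidPDE.IsLerayHopfOn T 1 0 (u 0) u → Literature.Analysis.FluidPDE.HasRapidSpatialDecay (u 0) → ∀ x₀ : EuclideanSpace ℝ (Fin 3), (∃ r₁ : ℝ, 0 < r₁ ∧ ∀ r ∈ Set.Ioo 0 r₁, Literature.Analysis.FluidPDE.cknC r ((T, x₀)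 : ℝ × EuclideanSpace ℝ (Fin 3)) u ≤ ENNReal.ofReal M) → ∃ ρ : ℝ, 0 < ρ ∧ ∃ M : ℝ, ∀ t ∈ Set.Ioo (T - ρ ^ 2) T, ∀ x ∈ Metric.ball x₀ ρ, ‖u t x‖ ≤ M := by
  -- adapted from the closed twin `Cruxes/SequentialTypeIExclusion/Lines/birth_closed.lean` (lead c2)
  intro hno M T hT u p hcl hLH _hdec x₀ hTI
  by_contra hB
  have hv := stub_lerayHopfLocalEnergySolution T hT u p hcl hLH
  have hmem : MeasureTheory.MemLp (u T) 2 MeasureTheory.volume := hLH.memLp T ⟨hT.le, le_rfl⟩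
  obtain ⟨U, P, hU, hagree⟩ := stub_continuationPastFinalTime T hT (u 0) u _ hv hmem
  have hsing :=
    stub_finalTimeTypeISingularPoint M T (T + 1) hT (by linarith) u p U P hcl hLH hU hagree x₀ hTI hB
  exact hno ⟨_, U, P, _, hsing⟩

/-- **The registered skeleton's composition with its two OPEN stubs as hypotheses:
S1 ⇐ (no scale-intermittency) ∧ ¬TypeISingularityExists** (reshape r4 of line `registered`; every other piece is
landed). -/
theorem sequentialTypeIExclusion_of_windowsForceTypeI_of_not_typeISingularityExists
    (hwin : ∀ M : ℝ, ∀ T : ℝ, 0 < T →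
      ∀ (u : ℝ → EuclideanSpace ℝ (Fin 3) → EuclideanSpace ℝ (Fin 3))
        (p : ℝ → EuclideanSpace ℝ (Fin 3) → ℝ),
        IsClassicalNSSolutionOn (Set.Ico 0 T) 1 0 u p →
        IsLerayHopfOn T 1 0 (u 0) u →
        HasRapidSpatialDecay (u 0) →
        ∀ x₀ : EuclideanSpace ℝ (Fin 3),
          (∀ r₀ : ℝ, 0 < r₀ → ∃ r ∈ Set.Ioo 0 r₀,
            cknC r ((T, x₀) : ℝ × EuclideanSpace ℝ (Fin 3)) u ≤ ENNReal.ofReal M) →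
          ∃ M' : ℝ, ∃ r₁ : ℝ, 0 < r₁ ∧ ∀ r ∈ Set.Ioo 0 r₁,
            cknC r ((T, x₀) : ℝ × EuclideanSpace ℝ (Fin 3)) u ≤ ENNReal.ofReal M')
    (hno : ¬ TypeISingularityExists) :
    Theses.SelfMixingDichotomy.SequentialTypeIExclusion :=
  sequentialTypeIExclusion_of_windowsForceTypeI_of_supForm hwin (supForm_of_not_typeISingularityExists hno)

end Summit.NavierStokesRegularity.NavierStokesRegularity.Theorems.SequentialTypeIExclusion.Registered

end
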